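import Summits.ABC.IUTFork.Conditional.WRowUnconditionalPackages
import HarnessLib

/-!
# R-W WINDOW-TABLE, W3 «UNIFORM LEMMA» lane, INHABITED side — bad primes and admissible index SHAPES at ANY level `l` (row «W:INHABITED-BANDS», C-R72)

PROOF-ONLY support file (D-0012; 0 definitions, 0 `Prop` facts) of the abc-iut cell — D-0079 RESCUE sub-cell R-W «WINDOW Θ-SIDE INEQUALITY», seat
abc-iut-W-num-6 (gen 3). For the genuine Θ-volume data over the known abc triple of `InhUniformBandFrey343.lean` (its consumer): which primes carry bad
fibre points at level `l` and with which pole order of `j` (`j` is regular away from `abc`; `p ≠ 2, l` — abc-iut-C-cert-3's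
`ne_two_and_ne_l_of_placeOf_mem_S_pilotDataOfK`), and the divisibility class `e(K_x/ℚ_p) ∈ E₀(p)·l·ℕ` of the ramification index at a bad `x | p`
from the tree's LOWER bounds (abc-iut-W-neg-1 `GenuineK.prime_dvd_absRamificationIdx_kOf_ratPoint` / `fifteen_mul_prime_dvd_…` (Tate root),
abc-iut-W-neg-2 `GenuineK.sub_one_dvd_absRamificationIdx_kOf` (`μ_p ⊆ F`, `p ∣ 30`) / `thirty_mul_prime_dvd_…_mul_three`, abc-iut-w4-d107's
unconditional twist factor `GenuineK.thirty_mul_prime_dvd_absRamificationIdx_kOf_mul_of_odd_pole` at an odd pole of `λ`). Pattern of abc-iut-w4-d094's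
`WRow.bad_prime_frey343` / abc-iut-W-row-1's `WRow.dvd_absRamificationIdx_frey283` with the level a variable. HONEST SCOPE: classical local/global
number theory over OUR typed datum; nothing here bears on the printed inequality of [IUTchIII] Cor. 3.12; typed ≠ proved; no abc claim.
[cite: Mochizuki2012, IUTchI Def. 3.1 (b),(c) pp. 61–62, Ex. 3.2 (iv) p. 71; IUTchIV Thm. 1.10 p. 22, Cor. 2.2 (ii) proof (P5) p. 46]
[cite: SilvermanATAEC1994, V.5 Thm. 5.3 and Cor. 5.4] [cite: SilvermanAEC2009, Prop. III.1.7(b), Prop. VII.5.1(b)] [cite: Washington1997, Prop. 2.1]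
[claim: Mochizuki2012, status: disputed] for every IUT sentence.
-/

noncomputable section

open Set Function Metric NumberField IsDedekindDomain

namespace Summit.ABC.IUTFork.Conditional

open Thm311 Thm311.Real Cor312 Cor312Vol Cor312Prov Literature.IUT.LogThetaLattice Literature.IUT.LogVolume
  Literature.IUT.HodgeTheaters Literature.IUT.LogVolume.Cor22
open Literature.NumberTheory.NumberFields Literature.NumberTheory.GaloisRepresentations.Ultrametric
open Literature.NumberTheory.DiophantineGeometry Literature.NumberTheory.DiophantineGeometry.GenEll

/-! ## §1. The bad primes and the admissible index shapes at ANY level `l` -/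

/-- **Which primes carry bad fibre points at `(ratPoint (343/59392), l)`, and the pole order there** (any level): a bad `x | p` has `p ≠ l` and
forces `p ∈ {3, 7, 29}` (`‖t_q(x)‖ < 1` for the chosen realising q-idele, i.e. a pole of `j`; `p ≠ 2`), with `ord₃ j = −20`, `ord₇ j = −6`,
`ord₂₉ j = −2` — abc-iut-w4-d094's `WRow.bad_prime_frey343` with the level a variable. [cite: Mochizuki2012, IUTchIV Cor. 2.2 (ii) proof (P5) p. 46] -/
theorem InhBand.bad_prime_frey343 {l : ℕ} (T : Cor22.ThetaVolumeDatumAt (ratPoint ((343 : ℚ) / 59392)) l) (pp : Nat.Primes) :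
    letI := T.instFieldF; letI := T.instNumberFieldF; letI := T.instAlgebraF; letI := T.instFieldK
    letI := T.instNumberFieldK; letI := T.instAlgebraK; letI := T.instFieldFbar; letI := T.instAlgebraFbar
    letI := T.instAlgebraKFbar; letI := T.instIsElliptic
    haveI : Fact (pp : ℕ).Prime := ⟨pp.2⟩
    ∀ x : (thetaIndex (pilotDataOfK T.D T.K)).Fibre (.inr pp), placeOf (pilotDataOfK T.D T.K) pp.1 x ∈ (pilotDataOfK T.D T.K).S →
      (pp : ℕ) ≠ l ∧
      (((pp : ℕ) = 3 ∧ ord ℚ (finBelow ℚ T.K (placeOf (pilotDataOfK T.D T.K) pp.1 x)) (jInv ((343 : ℚ) / 59392)) = -20) ∨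
      ((pp : ℕ) = 7 ∧ ord ℚ (finBelow ℚ T.K (placeOf (pilotDataOfK T.D T.K) pp.1 x)) (jInv ((343 : ℚ) / 59392)) = -6) ∨
      ((pp : ℕ) = 29 ∧ ord ℚ (finBelow ℚ T.K (placeOf (pilotDataOfK T.D T.K) pp.1 x)) (jInv ((343 : ℚ) / 59392)) = -2)) := by
  letI := T.instFieldF; letI := T.instNumberFieldF; letI := T.instAlgebraF; letI := T.instFieldK
  letI := T.instNumberFieldK; letI := T.instAlgebraK; letI := T.instFieldFbar; letI := T.instAlgebraFbar
  letI := T.instAlgebraKFbar; letI := T.instIsElliptic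
  haveI : Fact (pp : ℕ).Prime := ⟨pp.2⟩
  intro x hx
  have hjF : T.E.j = ((jInv ((343 : ℚ) / 59392) : ℚ) : T.F) := by rw [T.j_eq]; exact eq_ratCast _ _
  have hp1 : (1 : ℝ) < ((pp : ℕ) : ℝ) := by exact_mod_cast pp.2.one_lt
  have hgen := natGenerator_finBelow_placeOf T.D pp x
  have hl5 : 5 ≤ l := T.D.five_le_l
  -- a pole of `j` under the bad place
  have hneg : ord ℚ (finBelow ℚ T.K (placeOf (pilotDataOfK T.D T.K) pp.1 x)) (jInv ((343 : ℚ) / 59392)) < 0 := by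
    have hlt := norm_chosenQIdele_lt_one T.D pp x hx
    rw [norm_chosenQIdele_eq_rpow_ord_rat' T.D pp x hx _ hjF] at hlt
    by_contra hge
    push Not at hge
    have hl : (0 : ℝ) < 2 * (l : ℝ) := by
      have : (0 : ℝ) < (l : ℝ) := by exact_mod_cast (show 0 < l by omega)
      positivity
    have hexp : (0 : ℝ) ≤ (ord ℚ (finBelow ℚ T.K (placeOf (pilotDataOfK T.D T.K) pp.1 x)) (jInv ((343 : ℚ) / 59392)) : ℝ) /
        (2 * (l : ℝ)) := div_nonneg (by exact_mod_cast hge) hl.le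
    have h1 := (Real.rpow_le_rpow_left_iff hp1).mpr hexp
    rw [Real.rpow_zero] at h1
    linarith
  have hmem := WRow.natGenerator_mem_of_ord_neg_frey343 _ hneg
  rw [hgen] at hmem
  obtain ⟨h2, hl'⟩ := ne_two_and_ne_l_of_placeOf_mem_S_pilotDataOfK T.D pp x hx
  simp only [Finset.mem_insert, Finset.mem_singleton] at hmem
  have hord : ∀ {p₀ : ℕ}, (pp : ℕ) = p₀ → (p₀ = 3 ∨ p₀ = 7 ∨ p₀ = 29) →
      ord ℚ (finBelow ℚ T.K (placeOf (pilotDataOfK T.D T.K) pp.1 x)) (jInv ((343 : ℚ) / 59392)) =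
        -((if p₀ = 2 then 14 else if p₀ = 3 then 20 else if p₀ = 7 then 6 else 2 : ℕ) : ℤ) :=
    fun hp hp₀ => WRow.ord_jInv_frey343 _ (hgen.trans hp) hp₀
  refine ⟨hl', ?_⟩
  rcases hmem with h | h | h | h
  · exact absurd h h2
  · exact Or.inl ⟨h, by simpa using hord h (by norm_num)⟩
  · exact Or.inr (Or.inl ⟨h, by simpa using hord h (by norm_num)⟩)
  · exact Or.inr (Or.inr ⟨h, by simpa using hord h (by norm_num)⟩)

/-- **The admissible index shapes at the bad fibre, any level `l`**: at a bad `x | p`, `e(K_x/ℚ_p) = E₀(p)·l·m` with `m ≥ 1` and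
`E₀(3) = 6` (`2 ∣ e` from `μ_3 ⊆ F`; `3·l ∣ e` from the `30`-th root of the Tate parameter at `ord_3 j = −20` and the `l`-division layer — `l` odd),
`E₀(7) = 5` (`15·l ∣ 3e`), `E₀(29) = 15` (`15·l ∣ e`). [cite: SilvermanATAEC1994, V.5 Thm. 5.3 and Cor. 5.4] [cite: Washington1997, Prop. 2.1]
[cite: Mochizuki2012, IUTchI Ex. 3.2 (iv) p. 71; IUTchIV Thm. 1.10 p. 22] [claim: Mochizuki2012, status: disputed] -/
theorem InhBand.shape_frey343 {l : ℕ} (T : Cor22.ThetaVolumeDatumAt (ratPoint ((343 : ℚ) / 59392)) l) (pp : Nat.Primes) :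
    letI := T.instFieldF; letI := T.instNumberFieldF; letI := T.instAlgebraF; letI := T.instFieldK
    letI := T.instNumberFieldK; letI := T.instAlgebraK; letI := T.instFieldFbar; letI := T.instAlgebraFbar
    letI := T.instAlgebraKFbar; letI := T.instIsElliptic
    haveI : Fact (pp : ℕ).Prime := ⟨pp.2⟩
    ∀ x : (thetaIndex (pilotDataOfK T.D T.K)).Fibre (.inr pp), placeOf (pilotDataOfK T.D T.K) pp.1 x ∈ (pilotDataOfK T.D T.K).S →
      ∃ m : ℕ, 1 ≤ m ∧ absRamificationIdx (pp : ℕ) (kOf (pilotDataOfK T.D T.K) pp.1 x) =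
        (if (pp : ℕ) = 3 then 6 else if (pp : ℕ) = 7 then 5 else 15) * l * m := by
  letI := T.instFieldF; letI := T.instNumberFieldF; letI := T.instAlgebraF; letI := T.instFieldK
  letI := T.instNumberFieldK; letI := T.instAlgebraK; letI := T.instFieldFbar; letI := T.instAlgebraFbar
  letI := T.instAlgebraKFbar; letI := T.instIsElliptic
  haveI : Fact (pp : ℕ).Prime := ⟨pp.2⟩
  intro x hx
  have hl5 : 5 ≤ l := T.D.five_le_l
  have hlodd : Odd l := T.D.l_prime.odd_of_ne_two (by omega)
  have hpos := absRamificationIdx_pos (pp : ℕ) (kOf (pilotDataOfK T.D T.K) pp.1 x)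
  obtain ⟨hpl, hcases⟩ := InhBand.bad_prime_frey343 T pp x hx
  have hgen := natGenerator_finBelow_placeOf T.D pp x
  -- pole orders in the `∀ v` form the lower-bound lemmas want
  have hpole : ∀ {p₀ : ℕ} (t : ℕ), (p₀ = 3 ∧ t = 10) ∨ (p₀ = 7 ∧ t = 3) ∨ (p₀ = 29 ∧ t = 1) →
      ∀ v : HeightOneSpectrum (𝓞 ℚ), Rat.HeightOneSpectrum.natGenerator v = p₀ →
        ord ℚ v (jInv ((343 : ℚ) / 59392)) = -(2 * (t : ℤ)) := by
    intro p₀ t ht v hv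
    have hp₀ : p₀ = 3 ∨ p₀ = 7 ∨ p₀ = 29 := by rcases ht with h | h | h <;> simp [h.1]
    rw [WRow.ord_jInv_frey343 v hv hp₀]
    rcases ht with ⟨rfl, rfl⟩ | ⟨rfl, rfl⟩ | ⟨rfl, rfl⟩ <;> norm_num
  -- `E₀·l ∣ e` per prime, then `e = E₀·l·m`, `m ≥ 1`
  have hdvd : (if (pp : ℕ) = 3 then 6 else if (pp : ℕ) = 7 then 5 else 15) * l ∣
      absRamificationIdx (pp : ℕ) (kOf (pilotDataOfK T.D T.K) pp.1 x) := by
    rcases hcases with ⟨hp, -⟩ | ⟨hp, -⟩ | ⟨hp, -⟩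
    · have hpp : pp = ⟨3, Nat.prime_three⟩ := Subtype.ext hp
      subst hpp
      show 6 * l ∣ _
      have h2 : (3 - 1) ∣ absRamificationIdx 3 (kOf (pilotDataOfK T.D T.K) 3 x) :=
        GenuineK.sub_one_dvd_absRamificationIdx_kOf T ⟨3, Nat.prime_three⟩ (by norm_num) x
      have h30 : 30 * l ∣ absRamificationIdx 3 (kOf (pilotDataOfK T.D T.K) 3 x) * 10 :=
        GenuineK.thirty_mul_prime_dvd_absRamificationIdx_kOf_mul_three T (fun h => hpl h.symm) (t := 10) (by norm_num)
          (hpole 10 (Or.inl ⟨rfl, rfl⟩)) x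
      have h3l : 3 * l ∣ absRamificationIdx 3 (kOf (pilotDataOfK T.D T.K) 3 x) :=
        Nat.dvd_of_mul_dvd_mul_right (by norm_num : 0 < 10) (by rwa [show 3 * l * 10 = 30 * l by ring])
      have hcop : Nat.Coprime 2 (3 * l) := Nat.coprime_two_left.mpr ((by decide : Odd 3).mul hlodd)
      have h := Nat.Coprime.mul_dvd_of_dvd_of_dvd hcop (by norm_num at h2; exact h2) h3l
      rwa [show 2 * (3 * l) = 6 * l by ring] at h
    · simp only [hp, show (7 : ℕ) ≠ 3 by norm_num, if_false, if_true]
      have h15 : 15 * l ∣ absRamificationIdx (pp : ℕ) (kOf (pilotDataOfK T.D T.K) pp.1 x) * 3 :=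
        GenuineK.fifteen_mul_prime_dvd_absRamificationIdx_kOf_mul_ratPoint T pp (by rw [hp]; norm_num) hpl (t := 3) (by norm_num)
          (fun v hv => hpole 3 (Or.inr (Or.inl ⟨hp, rfl⟩)) v hv) x
      exact Nat.dvd_of_mul_dvd_mul_right (by norm_num : 0 < 3) (by rwa [show 5 * l * 3 = 15 * l by ring])
    · simp only [hp, show (29 : ℕ) ≠ 3 by norm_num, show (29 : ℕ) ≠ 7 by norm_num, if_false]
      exact GenuineK.fifteen_mul_prime_dvd_absRamificationIdx_kOf_ratPoint_of_coprime T pp (by rw [hp]; norm_num) hpl (t := 1)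
        (by norm_num) (by decide) (fun v hv => hpole 1 (Or.inr (Or.inr ⟨hp, rfl⟩)) v hv) x
  obtain ⟨m, hm⟩ := hdvd
  refine ⟨m, ?_, hm⟩
  rcases Nat.eq_zero_or_pos m with h0 | h0
  · rw [h0, mul_zero] at hm; omega
  · exact h0


end Summit.ABC.IUTFork.Conditional

end
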